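import Mathlib
import HarnessLib

/-!
# HANDOFF — WHICH POLE A SECULAR ROOT HUGS: the tail-capacity rule for the absorbed rung (cell rh-explicit, TRACK «HANDOFF»,
# seat theory-2 gen13; FILE XII-η, companion of XII-x `HandoffSecularPencil` (p385944) and XII-x′ `HandoffSecularGaps` (p386372))

HONEST FRAMING. Nothing here bears on the truth of RH; this is elementary one-variable algebra on the secular equation
`s·Σ_k a_k²/(E_k − λ) = 1` of the rank-one pencil `diag(E) − s·a aᵀ` (a finite ladder `E : ι → ℝ`, couplings `a`, `s > 0`).
XII-x/XII-x′ give ONE root per gap between consecutive live rungs and one root below the ladder iff the capacity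
`s·Σ_k a_k²/E_k` exceeds `1`. This file says WHERE in the gap the root sits, by four explicit inequalities (no asymptotics):

* `sub_le_of_secular_root_of_one_lt_tail` — in the gap `(E_i, E_j)`, if the TAIL CAPACITY of the rungs from `E_j` upward,
  `T = s·Σ_{E_j ≤ E_k} a_k²/E_k`, exceeds `1` by more than the back-reaction `B = s·Σ_{E_k < E_i} a_k²/(E_i − E_k)` of the rungs
  below, then the root hugs the LOWER pole: `λ − E_i ≤ s·a_i²/(T − B − 1)`;
* `sub_le_of_secular_root_of_tail_lt_one` — if the capacity of the rungs strictly above `E_j`, measured from `E_j`,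
  `T' = s·Σ_{E_j < E_k} a_k²/(E_k − E_j)`, is `< 1`, the root hugs the UPPER pole: `E_j − λ ≤ s·a_j²/(1 − T')`;
* `mul_le_neg_of_secular_root_nonpos` — a root `λ ≤ 0` below a positive ladder satisfies `E_m·(T_m − 1) ≤ −λ` for EVERY rung
  `E_m > 0`, `T_m = s·Σ_{E_m ≤ E_k} a_k²/E_k` (the negative eigenvalue lives at least at the scale of any rung whose upward capacity
  still exceeds `1`);
* `neg_le_of_secular_root_nonpos` — and `−λ ≤ (s·Σ_{E_k ≤ E_m} a_k²)/(1 − T°_m)` whenever the capacity strictly above `E_m`,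
  `T°_m = s·Σ_{E_m < E_k} a_k²/E_k`, is `< 1`.

READING (DATA side, DERIVED-CHECK single-lineage, theory-2 gen13 `edgesign/gen13/TAILCAP-rule-*.txt`; per cell, finite sections;
not kernel): in a geometric ladder (`E_{k+1}/E_k ≈ 10⁶…10⁹`, the cell's near-null ladders) `B` and the differences between `T`, `T'`,
`T°` computed «at `E_j`» or «at `0`» are negligible, and the four bounds collapse to closed forms — lower pole ×`(1 + c_k/(T_k − 1))`
when `T_k > 1`, upper pole ×`(1 − T_k)/(1 − T_{k+1})` when `T_k < 1`, negative root `E_m(T_{m−1} − 1)/(1 − T_m)` — with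
`c_k = s a_k²/E_k`, `T_k = Σ_{j>k} c_j (+ remainder)`. Hence THE TAIL-CAPACITY RULE: the rung whose node pattern is ABSENT from the
positive spectrum of the deleted window form is `m̂ = min {k : T_k < 1}` — delete rungs from the bottom until what is left can no
longer bind; on cc-s2-3's cc6-hp records this reproduces the dominant-weight `m̂` of theory-2 gen11's census in 18/18 odd negative
cells and the observed bottom node pattern in 16/16, and the closed forms equal the bisection roots of the scalar secular model to
4 digits (K29/K31 lifted cells: observed positive modes within 2–5 % of them away from `m̂`, ×1.6–4 next to `m̂`, where the coherent
model is known to over-bind). It also explains the direction theory-2 gen12 got wrong in its sealed ADD7 (L31-2): below `m̂` the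
positive modes sit ABOVE their rungs (in the next gap), not below. Folklore algebra (Golub 1973; Bunch–Nielsen–Sorensen 1978 for the
interlacing frame); the capacity bookkeeping is the cell's.
-/

set_option linter.dupNamespace false  -- the mandated namespace repeats `RiemannHypothesis`

open Finset

namespace Summit.RiemannHypothesis.RiemannHypothesis.Theorems.HandoffSecularHugging

variable {ι : Type*} [Fintype ι] [DecidableEq ι]

/-- **LOWER-POLE HUGGING.** Let `λ ∈ (E_i, E_j)` solve the secular equation `s·Σ_k a_k²/(E_k − λ) = 1` (`s > 0`, `λ > 0`), the gap
being clean: every rung other than `i` lies strictly below `E_i` or at/above `E_j`. With the tail capacity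
`T = s·Σ_{E_j ≤ E_k} a_k²/E_k` and the back-reaction `B = s·Σ_{E_k < E_i} a_k²/(E_i − E_k)`: if `1 < T − B` then
`λ − E_i ≤ s·a_i²/(T − B − 1)` — the root sits just above its lower pole, within «gain over excess capacity». (Each term with
`E_j ≤ E_k` is `≥ s a_k²/E_k` because `0 < E_k − λ ≤ E_k`; each term with `E_k < E_i` is `≥ −s a_k²/(E_i − E_k)`; the `i`-term is
`−s a_i²/(λ − E_i)`; summing, `1 ≥ T − B − s a_i²/(λ − E_i)`.) [folklore algebra; the cell's capacity bookkeeping] -/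
theorem sub_le_of_secular_root_of_one_lt_tail {E a : ι → ℝ} {s lam : ℝ} (hs : 0 < s) {i j : ι} (hlam0 : 0 < lam)
    (hi : E i < lam) (hj : lam < E j) (hgap : ∀ k, k = i ∨ E k < E i ∨ E j ≤ E k)
    (hsec : s * ∑ k, a k ^ 2 / (E k - lam) = 1)
    (hT : 1 < s * (∑ k ∈ univ.filter (fun k ↦ E j ≤ E k), a k ^ 2 / E k)
            - s * (∑ k ∈ univ.filter (fun k ↦ E k < E i), a k ^ 2 / (E i - E k))) :
    lam - E i ≤ s * a i ^ 2 /
      (s * (∑ k ∈ univ.filter (fun k ↦ E j ≤ E k), a k ^ 2 / E k)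
        - s * (∑ k ∈ univ.filter (fun k ↦ E k < E i), a k ^ 2 / (E i - E k)) - 1) := by
  set T : ℝ := s * (∑ k ∈ univ.filter (fun k ↦ E j ≤ E k), a k ^ 2 / E k) with hT_def
  set B : ℝ := s * (∑ k ∈ univ.filter (fun k ↦ E k < E i), a k ^ 2 / (E i - E k)) with hB_def
  have hd : 0 < lam - E i := by linarith
  -- termwise lower bound
  have key : T - B - s * a i ^ 2 / (lam - E i) ≤ s * ∑ k, a k ^ 2 / (E k - lam) := by
    have hsplit : T - B - s * a i ^ 2 / (lam - E i)
        = s * ∑ k, ((if E j ≤ E k then a k ^ 2 / E k else 0) - (if E k < E i then a k ^ 2 / (E i - E k) else 0)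
            - (if k = i then a i ^ 2 / (lam - E i) else 0)) := by
      rw [Finset.sum_sub_distrib, Finset.sum_sub_distrib, ← Finset.sum_filter, ← Finset.sum_filter,
        Finset.sum_ite_eq' univ i, if_pos (Finset.mem_univ i), hT_def, hB_def]
      ring
    rw [hsplit, Finset.mul_sum, Finset.mul_sum]
    refine Finset.sum_le_sum fun k _ ↦ ?_
    refine mul_le_mul_of_nonneg_left ?_ hs.le
    rcases hgap k with hk | hk | hk
    · -- k = i
      subst hk
      have h1 : ¬ (E j ≤ E k) := not_le.mpr (lt_trans hi hj)
      have h2 : ¬ (E k < E k) := lt_irrefl _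
      rw [if_neg h1, if_neg h2, if_pos rfl]
      have : a k ^ 2 / (E k - lam) = -(a k ^ 2 / (lam - E k)) := by
        rw [← div_neg, neg_sub]
      rw [this]; ring_nf; exact le_rfl
    · -- E k < E i : term ≥ -(a_k²/(E_i - E_k))
      have h1 : ¬ (E j ≤ E k) := not_le.mpr (by linarith)
      have h3 : k ≠ i := fun h ↦ by subst h; exact lt_irrefl _ hk
      rw [if_neg h1, if_pos hk, if_neg h3]
      have hpos : 0 < E i - E k := by linarith
      have hneg : 0 < lam - E k := by linarith
      have : a k ^ 2 / (E k - lam) = -(a k ^ 2 / (lam - E k)) := by rw [← div_neg, neg_sub]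
      rw [this]
      have : a k ^ 2 / (lam - E k) ≤ a k ^ 2 / (E i - E k) :=
        div_le_div_of_nonneg_left (sq_nonneg _) hpos (by linarith)
      linarith
    · -- E j ≤ E k : term ≥ a_k²/E_k
      have h2 : ¬ (E k < E i) := not_lt.mpr (by linarith)
      have h3 : k ≠ i := fun h ↦ by subst h; linarith
      rw [if_pos hk, if_neg h2, if_neg h3]
      have hEk : 0 < E k := by linarith
      have hden : 0 < E k - lam := by linarith
      have : a k ^ 2 / E k ≤ a k ^ 2 / (E k - lam) :=
        div_le_div_of_nonneg_left (sq_nonneg _) hden (by linarith)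
      linarith
  rw [hsec] at key
  -- 1 ≥ T - B - s a_i²/(lam - E_i)  ⟹  s a_i²/(lam - E_i) ≥ T - B - 1 > 0
  have hq : T - B - 1 ≤ s * a i ^ 2 / (lam - E i) := by linarith
  have hpos : 0 < T - B - 1 := by linarith
  rw [le_div_iff₀ hpos]
  have := (le_div_iff₀ hd).mp hq
  linarith

/-- **UPPER-POLE HUGGING.** Let `λ ∈ (E_i, E_j)` solve `s·Σ_k a_k²/(E_k − λ) = 1` (`s > 0`), every rung other than `j` lying at/below
`E_i` or strictly above `E_j`. With `T' = s·Σ_{E_j < E_k} a_k²/(E_k − E_j)` (the capacity of the rungs above the gap, measured from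
its upper end): if `T' < 1` then `E_j − λ ≤ s·a_j²/(1 − T')` — the root sits just below its upper pole, within «gain over capacity
deficit». (Drop the nonpositive terms `E_k ≤ E_i`; bound each term `E_j < E_k` by `s a_k²/(E_k − E_j)`; so
`1 ≤ s a_j²/(E_j − λ) + T'`.) [folklore algebra; the cell's capacity bookkeeping] -/
theorem sub_le_of_secular_root_of_tail_lt_one {E a : ι → ℝ} {s lam : ℝ} (hs : 0 < s) {i j : ι}
    (hi : E i < lam) (hj : lam < E j) (hgap : ∀ k, k = j ∨ E k ≤ E i ∨ E j < E k)
    (hsec : s * ∑ k, a k ^ 2 / (E k - lam) = 1)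
    (hT : s * (∑ k ∈ univ.filter (fun k ↦ E j < E k), a k ^ 2 / (E k - E j)) < 1) :
    E j - lam ≤ s * a j ^ 2 / (1 - s * (∑ k ∈ univ.filter (fun k ↦ E j < E k), a k ^ 2 / (E k - E j))) := by
  set T : ℝ := s * (∑ k ∈ univ.filter (fun k ↦ E j < E k), a k ^ 2 / (E k - E j)) with hT_def
  have hd : 0 < E j - lam := by linarith
  have key : s * ∑ k, a k ^ 2 / (E k - lam) ≤ T + s * a j ^ 2 / (E j - lam) := by
    have hsplit : T + s * a j ^ 2 / (E j - lam)
        = s * ∑ k, ((if E j < E k then a k ^ 2 / (E k - E j) else 0) + (if k = j then a j ^ 2 / (E j - lam) else 0)) := by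
      rw [Finset.sum_add_distrib, ← Finset.sum_filter, Finset.sum_ite_eq' univ j, if_pos (Finset.mem_univ j), hT_def]
      ring
    rw [hsplit, Finset.mul_sum, Finset.mul_sum]
    refine Finset.sum_le_sum fun k _ ↦ ?_
    refine mul_le_mul_of_nonneg_left ?_ hs.le
    rcases hgap k with hk | hk | hk
    · subst hk
      rw [if_neg (lt_irrefl _), if_pos rfl]; simp
    · have h1 : ¬ (E j < E k) := not_lt.mpr (by linarith)
      have h3 : k ≠ j := fun h ↦ by subst h; linarith
      rw [if_neg h1, if_neg h3, add_zero]
      exact div_nonpos_of_nonneg_of_nonpos (sq_nonneg _) (by linarith)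
    · have h3 : k ≠ j := fun h ↦ by subst h; exact lt_irrefl _ hk
      rw [if_pos hk, if_neg h3, add_zero]
      have hden : 0 < E k - E j := by linarith
      exact div_le_div_of_nonneg_left (sq_nonneg _) hden (by linarith)
  rw [hsec] at key
  have hq : 1 - T ≤ s * a j ^ 2 / (E j - lam) := by linarith
  have hpos : 0 < 1 - T := by linarith
  rw [le_div_iff₀ hpos]
  have := (le_div_iff₀ hd).mp hq
  linarith

omit [DecidableEq ι] in
/-- **THE NEGATIVE ROOT LIVES AT THE SCALE OF THE OVER-BINDING TAIL (lower bound).** Let `λ ≤ 0` solve `s·Σ_k a_k²/(E_k − λ) = 1`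
(`s > 0`) below a ladder lying entirely above `λ` (`λ < E_k` for all `k`). For every rung `E_m > 0`, with the upward capacity
`T_m = s·Σ_{E_m ≤ E_k} a_k²/E_k`: `E_m·(T_m − 1) ≤ −λ`. (Terms below `E_m` are `≥ 0`; for `E_m ≤ E_k`,
`E_k − λ ≤ E_k·(E_m − λ)/E_m`, so the tail contributes `≥ T_m·E_m/(E_m − λ)`.) In the cell's reading: `|ε₁| ≥ λ_m(T_m − 1)` for
every rung whose upward capacity still exceeds one. [folklore algebra; the cell's capacity bookkeeping] -/
theorem mul_le_neg_of_secular_root_nonpos {E a : ι → ℝ} {s lam : ℝ} (hs : 0 < s) (hlam : lam ≤ 0)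
    (habove : ∀ k, lam < E k) (hsec : s * ∑ k, a k ^ 2 / (E k - lam) = 1) {m : ι} (hm : 0 < E m) :
    E m * (s * (∑ k ∈ univ.filter (fun k ↦ E m ≤ E k), a k ^ 2 / E k) - 1) ≤ -lam := by
  set T : ℝ := s * (∑ k ∈ univ.filter (fun k ↦ E m ≤ E k), a k ^ 2 / E k) with hT_def
  have hEl : 0 < E m - lam := by linarith
  -- tail terms: a_k²/(E_k - lam) ≥ (a_k²/E_k) * (E m / (E m - lam))
  have key : T * (E m / (E m - lam)) ≤ s * ∑ k, a k ^ 2 / (E k - lam) := by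
    have hsplit : T * (E m / (E m - lam))
        = s * ∑ k, (if E m ≤ E k then a k ^ 2 / E k * (E m / (E m - lam)) else 0) := by
      rw [← Finset.sum_filter, hT_def, ← Finset.sum_mul]; ring
    rw [hsplit, Finset.mul_sum, Finset.mul_sum]
    refine Finset.sum_le_sum fun k _ ↦ mul_le_mul_of_nonneg_left ?_ hs.le
    have hk0 : 0 < E k - lam := by linarith [habove k]
    by_cases hk : E m ≤ E k
    · rw [if_pos hk]
      have hEk : 0 < E k := by linarith
      -- a²/E_k · E_m/(E_m - lam) ≤ a²/(E_k - lam)  ⟸  E_m (E_k - lam) ≤ E_k (E_m - lam)  ⟸  -lam E_m ≤ -lam E_k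
      rw [div_mul_div_comm, div_le_div_iff₀ (mul_pos hEk hEl) hk0]
      have h1 : E m * (E k - lam) ≤ E k * (E m - lam) := by nlinarith
      calc a k ^ 2 * E m * (E k - lam) = a k ^ 2 * (E m * (E k - lam)) := by ring
        _ ≤ a k ^ 2 * (E k * (E m - lam)) := mul_le_mul_of_nonneg_left h1 (sq_nonneg _)
        _ = a k ^ 2 * (E k * (E m - lam)) := rfl
    · rw [if_neg hk]
      exact div_nonneg (sq_nonneg _) hk0.le
  rw [hsec] at key
  -- T · E_m/(E_m - lam) ≤ 1 ⟹ T E_m ≤ E_m - lam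
  have h2 : T * E m ≤ E m - lam := by
    have := key
    rw [← mul_div_assoc, div_le_iff₀ hEl] at this
    linarith
  nlinarith

omit [DecidableEq ι] in
/-- **THE NEGATIVE ROOT LIVES AT THE SCALE OF THE OVER-BINDING TAIL (upper bound).** Let `λ ≤ 0` solve `s·Σ_k a_k²/(E_k − λ) = 1`
(`s > 0`) below a nonnegative ladder (`0 ≤ E_k`, `λ < E_k` for all `k`). For any rung `m`, with the capacity strictly above it
`T°_m = s·Σ_{E_m < E_k} a_k²/E_k < 1` and the gains at/below it `G_m = s·Σ_{E_k ≤ E_m} a_k²`: `−λ ≤ G_m/(1 − T°_m)`. (Terms at/below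
`E_m` are `≤ s a_k²/(−λ)`, terms above are `≤ s a_k²/E_k`.) With the lower bound: the negative eigenvalue is pinned between
`E_m(T_m − 1)` and `G_m/(1 − T°_m)` at the rung `m = m̂` where the upward capacity crosses one — the TAIL-CAPACITY RULE for the
absorbed rung. [folklore algebra; the cell's capacity bookkeeping] -/
theorem neg_le_of_secular_root_nonpos {E a : ι → ℝ} {s lam : ℝ} (hs : 0 < s) (hlam : lam ≤ 0) (hE : ∀ k, 0 ≤ E k)
    (habove : ∀ k, lam < E k) (hsec : s * ∑ k, a k ^ 2 / (E k - lam) = 1) (m : ι)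
    (hT : s * (∑ k ∈ univ.filter (fun k ↦ E m < E k), a k ^ 2 / E k) < 1) :
    -lam ≤ s * (∑ k ∈ univ.filter (fun k ↦ E k ≤ E m), a k ^ 2)
      / (1 - s * (∑ k ∈ univ.filter (fun k ↦ E m < E k), a k ^ 2 / E k)) := by
  set T : ℝ := s * (∑ k ∈ univ.filter (fun k ↦ E m < E k), a k ^ 2 / E k) with hT_def
  set G : ℝ := s * (∑ k ∈ univ.filter (fun k ↦ E k ≤ E m), a k ^ 2) with hG_def
  have hpos : 0 < 1 - T := by linarith
  have hG0 : 0 ≤ G := mul_nonneg hs.le (Finset.sum_nonneg fun k _ ↦ sq_nonneg _)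
  rcases eq_or_lt_of_le hlam with h0 | hneg
  · rw [h0, neg_zero]; exact div_nonneg hG0 hpos.le
  have hL : 0 < -lam := by linarith
  -- 1 = s Σ ≤ G/(-lam) + T
  have key : s * ∑ k, a k ^ 2 / (E k - lam) ≤ G / (-lam) + T := by
    have hsplit : G / (-lam) + T
        = s * ∑ k, ((if E k ≤ E m then a k ^ 2 / (-lam) else 0) + (if E m < E k then a k ^ 2 / E k else 0)) := by
      rw [Finset.sum_add_distrib, ← Finset.sum_filter, ← Finset.sum_filter, hG_def, hT_def, mul_div_assoc, Finset.sum_div]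
      ring
    rw [hsplit, Finset.mul_sum, Finset.mul_sum]
    refine Finset.sum_le_sum fun k _ ↦ mul_le_mul_of_nonneg_left ?_ hs.le
    have hk0 : 0 < E k - lam := by linarith [habove k]
    by_cases hk : E k ≤ E m
    · rw [if_pos hk, if_neg (not_lt.mpr hk), add_zero]
      exact div_le_div_of_nonneg_left (sq_nonneg _) hL (by linarith [hE k])
    · rw [if_neg hk, if_pos (not_le.mp hk), zero_add]
      have hEk : 0 < E k := lt_of_le_of_lt (hE m) (not_le.mp hk)
      exact div_le_div_of_nonneg_left (sq_nonneg _) hEk (by linarith)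
  rw [hsec] at key
  have h2 : 1 - T ≤ G / (-lam) := by linarith
  rw [le_div_iff₀ hL] at h2
  rw [le_div_iff₀ hpos]
  linarith

/-! ## §2 MODE PURITY: a root that hugs a pole IS that rung's mode (theory-2 gen13 append)

The eigenvector of `diag(E) − s·a aᵀ` for an eigenvalue `λ` off the ladder is `x_j = a_j/(E_j − λ)` (XII-x `eigen_of_secular`,
`eigen_component_ratio`). If `λ` sits within `ε` of the rung `E_k` and at distance `≥ Δ_j` from each other rung `E_j`, the weight
off rung `k` is at most `ε²·(Σ_{j≠k} a_j²/Δ_j²)/a_k²` times the weight on rung `k`. In the cell's geometric ladders (§1's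
`ε ≈ 0.2·E_k`, `Δ_j ≈ E_j` above and `≈ E_k` below, couplings `a_j² ∝ c_j E_j`) every term is `≈ (ε/E_k)²·(c_j/c_k)·
min(E_k/E_j, E_j/E_k) ≲ 1e−9`: the positive modes of the deleted form are single rungs of the full form to that accuracy — the
kernel half of «the mode in gap k carries pattern k (resp. k + 1)»; that rung `k`'s function has the k-th universal node pattern is
DATA. -/

/-- Weight ON the hugged rung: if `0 < |E_k − λ| ≤ ε` then `(a_k/(E_k − λ))² ≥ a_k²/ε²` (so `ε > 0` automatically). [folklore algebra] -/
theorem sq_div_ge_of_abs_sub_le {Ek ak lam ε : ℝ} (hne : Ek ≠ lam) (hclose : |Ek - lam| ≤ ε) :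
    ak ^ 2 / ε ^ 2 ≤ (ak / (Ek - lam)) ^ 2 := by
  have hd : 0 < |Ek - lam| := abs_pos.mpr (sub_ne_zero.mpr hne)
  rw [div_pow, ← sq_abs (Ek - lam)]
  exact div_le_div_of_nonneg_left (sq_nonneg _) (pow_pos hd 2) (pow_le_pow_left₀ hd.le hclose 2)

/-- Weight OFF the hugged rung, rung by rung: if each rung `j ≠ k` is at distance `≥ Δ_j > 0` from `λ`, then
`Σ_{j≠k} (a_j/(E_j − λ))² ≤ Σ_{j≠k} a_j²/Δ_j²`. [folklore algebra] -/
theorem sum_sq_div_le_of_le_abs_sub {E a Δ : ι → ℝ} {lam : ℝ} (k : ι) (hΔ : ∀ j, j ≠ k → 0 < Δ j)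
    (hfar : ∀ j, j ≠ k → Δ j ≤ |E j - lam|) :
    ∑ j ∈ univ.erase k, (a j / (E j - lam)) ^ 2 ≤ ∑ j ∈ univ.erase k, a j ^ 2 / Δ j ^ 2 := by
  refine Finset.sum_le_sum fun j hj ↦ ?_
  have hjk : j ≠ k := Finset.ne_of_mem_erase hj
  rw [div_pow, ← sq_abs (E j - lam)]
  exact div_le_div_of_nonneg_left (sq_nonneg _) (pow_pos (hΔ j hjk) 2) (pow_le_pow_left₀ (hΔ j hjk).le (hfar j hjk) 2)

/-- **MODE PURITY.** Let `x_j = a_j/(E_j − λ)` be the secular eigenvector (XII-x `eigen_of_secular`) of an eigenvalue `λ` that hugs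
the rung `E_k`: `0 < |E_k − λ| ≤ ε`, each other rung at distance `≥ Δ_j > 0` from `λ`, and `a_k ≠ 0`. Then the weight off rung `k`
is controlled by the weight on it: `Σ_{j≠k} x_j² ≤ ε²·((Σ_{j≠k} a_j²/Δ_j²)/a_k²)·x_k²`. With §1's `ε` (`s a_k²/(T − B − 1)` below the
absorbed rung, `s a_j²/(1 − T′)` above it) and the cell's geometric ladders each term is `≲ 1e−9`: every positive mode of the deleted
window form is ONE rung of the full form — the kernel half of LADDER (L12)'s pattern rule (the node count of rung `k` itself is
DATA). [folklore algebra; the cell's bookkeeping] -/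
theorem offRung_weight_le {E a Δ : ι → ℝ} {lam ε : ℝ} (k : ι) (hε : 0 < ε) (hΔ : ∀ j, j ≠ k → 0 < Δ j) (hak : a k ≠ 0)
    (hne : E k ≠ lam) (hclose : |E k - lam| ≤ ε) (hfar : ∀ j, j ≠ k → Δ j ≤ |E j - lam|) :
    ∑ j ∈ univ.erase k, (a j / (E j - lam)) ^ 2
      ≤ ε ^ 2 * ((∑ j ∈ univ.erase k, a j ^ 2 / Δ j ^ 2) / a k ^ 2) * (a k / (E k - lam)) ^ 2 := by
  have h1 := sum_sq_div_le_of_le_abs_sub (a := a) k hΔ hfar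
  have h2 := sq_div_ge_of_abs_sub_le (ak := a k) hne hclose
  have hA : 0 ≤ ∑ j ∈ univ.erase k, a j ^ 2 / Δ j ^ 2 :=
    Finset.sum_nonneg fun j hj ↦ div_nonneg (sq_nonneg _) (le_of_lt (pow_pos (hΔ j (Finset.ne_of_mem_erase hj)) 2))
  have hak2 : 0 < a k ^ 2 := by positivity
  have h3 : 1 ≤ ε ^ 2 / a k ^ 2 * (a k / (E k - lam)) ^ 2 := by
    rw [div_mul_eq_mul_div, le_div_iff₀ hak2, one_mul]
    have := mul_le_mul_of_nonneg_left h2 (le_of_lt (pow_pos hε 2))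
    rwa [mul_div_assoc', mul_div_cancel_left₀ _ (pow_pos hε 2).ne'] at this
  calc ∑ j ∈ univ.erase k, (a j / (E j - lam)) ^ 2
      ≤ ∑ j ∈ univ.erase k, a j ^ 2 / Δ j ^ 2 := h1
    _ = (∑ j ∈ univ.erase k, a j ^ 2 / Δ j ^ 2) * 1 := (mul_one _).symm
    _ ≤ (∑ j ∈ univ.erase k, a j ^ 2 / Δ j ^ 2) * (ε ^ 2 / a k ^ 2 * (a k / (E k - lam)) ^ 2) :=
        mul_le_mul_of_nonneg_left h3 hA
    _ = ε ^ 2 * ((∑ j ∈ univ.erase k, a j ^ 2 / Δ j ^ 2) / a k ^ 2) * (a k / (E k - lam)) ^ 2 := by ring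

end Summit.RiemannHypothesis.RiemannHypothesis.Theorems.HandoffSecularHugging
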